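import Summits.CriticalPhenomena.SAWScalingLimit.Theorems.SAWRestrictionRigidityRigidityOfCocycleCore
import Literature.Probability.RandomPlanarGeometry.ConformalRestrictionProofs

/-!
# `Rigidity` is kernel-equivalent to its scalar core (line `registered`), crux `Rigidity` (stmt-CriticalPhenomena-1368), route SAWRestrictionRigidity

Target: `Summits/CriticalPhenomena/SAWScalingLimit/Theorems/SAWRestrictionRigidityRigidityIffCocycleCore.lean`
(`--supports stmt-CriticalPhenomena-1368`).

`core_of_rigidity : Rigidity → core` (push the avoidance event through `P D₂ = Φ_* (P D)`; on the
`P D`-full event `{γ ⊆ closure D}` injectivity of `Φ` on `closure D` makes `{Φ γ ⊆ Φ (closure D')}`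
and `{γ ⊆ closure D'}` coincide) and, with the landed reduction `rigidity_of_cocycleCore`
(core → Rigidity), the equivalence `rigidity_iff_cocycleCore : Rigidity ↔ core`. Here `core` is the
registered stub statement `stub_cocycleConformal` of the line verbatim: under the crux hypotheses the
avoidance cocycle `c(D, D') = P D {γ ⊆ closure D'}` is invariant along continuous plane maps `Φ`
agreeing on `D` with a conformal equivalence `g : D → D₂` (marked points as boundary values),
injective on `closure D`, with `Φ(closure D') = closure D₂'`, on sub-domains agreeing with the big
domains near the marked points. So the crux carries exactly the content of this one scalar
functional statement (open in print: LSW04 §3.4.5, Beffara 2008 Prop. 4).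
-/

noncomputable section

namespace Summit.CriticalPhenomena.SAWScalingLimit.Cruxes.Rigidity.Cocycle

open MeasureTheory Set
open Literature.Probability.RandomPlanarGeometry

/-- The scalar core is a consequence of the crux: conformal covariance of `P` makes the avoidance
cocycle conformally invariant along maps injective on the closed domain. LSW03 §3 ("the law of K is determined by P[K ∩ A = ∅]") read backwards. [folklore] -/
theorem core_of_rigidity
    (hR : Summit.CriticalPhenomena.SAWScalingLimit.Theses.SAWRestrictionRigidity.Rigidity) :
    ∀ P : Literature.Probability.RandomPlanarGeometry.ChordalFamily, P.IsChordal → P.IsRestriction → (∃ Q : Literature.Probability.RandomPlanarGeometry.DobrushinDomain → Literature.Probability.RandomPlanarGeometry.CurveClass ℂ → MeasureTheory.Measure (Literature.Probability.RandomPlanarGeometry.CurveClass ℂ), P.IsMarkovExtension Q ∧ ∀ (D : Literature.Probability.RandomPlanarGeometry.DobrushinDomain) (p : Literature.Probability.RandomPlanarGeometry.CurveClass ℂ) (D' : Literature.Probability.RandomPlanarGeometry.DobrushinDomain), D'.carrier ⊆ Literature.Probability.RandomPlanarGeometry.remainingDomain D p → D'.pt 0 = p.target → D'.pt 1 = D.pt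 1 → ∀ T : Set (Literature.Probability.RandomPlanarGeometry.CurveClass ℂ), MeasurableSet T → P D' T * Q D p (Literature.Probability.RandomPlanarGeometry.CurveClass.rangeSubset (closure D'.carrier)) = Q D p (T ∩ Literature.Probability.RandomPlanarGeometry.CurveClass.rangeSubset (closure D'.carrier))) → (∀ D D' : Literature.Probability.RandomPlanarGeometry.DobrushinDomain, D'.carrier = D.carrier → D'.pt 0 = D.pt 1 → D'.pt 1 = D.pt 0 → P D' = (P D).map Literature.Probability.RandomPlanarGeometry.CurveClass.reverse) → (∀ (D : Literature.Probability.RandomPlanarGeometry.DobrushinDomain) (c : ℂ) (hc : c ≠ 0) (w : ℂ), (∃ (r : ℝ) (k : ℕ), 0 < r ∧ c = (r : ℂ) * Complex.I ^ k) → P (D.map (Literature.Probability.RandomPlanarGeometry.similarity c hc w)) = (P D).map (Literature.Probability.RandomPlanarGeometry.CurveClass.map (Literature.Probability.RandomPlanarGeometry.similarity c hc w : C(ℂ, ℂ)))) → (∀ D : Literature.Probability.RandomPlanarGeometry.DobrushinDomain, P (D.map Complex.conjLIE.toHomeomorph) = (P D).map (Literature.Probability.RandomPlanarGeometry.CurveClass.map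 (Complex.conjLIE.toHomeomorph : C(ℂ, ℂ)))) → (∀ D : Literature.Probability.RandomPlanarGeometry.DobrushinDomain, ∀ᵐ γ ∂(P D), γ ∈ Literature.Probability.RandomPlanarGeometry.CurveClass.simple ∧ γ.range ∩ frontier D.carrier ⊆ {D.pt 0, D.pt 1}) → ∀ (D D₂ : Literature.Probability.RandomPlanarGeometry.DobrushinDomain) (g : Literature.Probability.RandomPlanarGeometry.ConformalEquiv D.carrier D₂.carrier) (Φ : C(ℂ, ℂ)), g.HasBoundaryValue (D.pt 0) (D₂.pt 0) → g.HasBoundaryValue (D.pt 1) (D₂.pt 1) → Set.EqOn Φ g D.carrier → Set.InjOn Φ (closure D.carrier) → ∀ (D' D₂' : Literature.Probability.RandomPlanarGeometry.DobrushinDomain), D'.carrier ⊆ D.carrier → D'.pt 0 = D.pt 0 → D'.pt 1 = D.pt 1 → D₂'.carrier ⊆ D₂.carrier → D₂'.pt 0 = D₂.pt 0 → D₂'.pt 1 = D₂.pt 1 → (∃ ε : ℝ, 0 < ε ∧ D'.carrier ∩ Metric.ball (D.pt 0) ε = D.carrier ∩ Metric.ball (D.pt 0) ε ∧ D'.carrier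 ∩ Metric.ball (D.pt 1) ε = D.carrier ∩ Metric.ball (D.pt 1) ε) → (∃ ε : ℝ, 0 < ε ∧ D₂'.carrier ∩ Metric.ball (D₂.pt 0) ε = D₂.carrier ∩ Metric.ball (D₂.pt 0) ε ∧ D₂'.carrier ∩ Metric.ball (D₂.pt 1) ε = D₂.carrier ∩ Metric.ball (D₂.pt 1) ε) → Φ '' closure D'.carrier = closure D₂'.carrier → P D (Literature.Probability.RandomPlanarGeometry.CurveClass.rangeSubset (closure D'.carrier)) = P D₂ (Literature.Probability.RandomPlanarGeometry.CurveClass.rangeSubset (closure D₂'.carrier)) := by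
  intro P hch hres hmk hrev hsim hconj hsimple D D₂ g Φ hb0 hb1 heq hinj D' D₂' hsub _ _ _ _ _ _ _ hcl
  have hcc : P.IsConformallyCovariant := hR P hch hres hmk hrev hsim hconj hsimple
  have hΦm : Measurable (CurveClass.map Φ) := CurveClass.measurable_map Φ
  rw [hcc D D₂ g Φ hb0 hb1 heq, Measure.map_apply hΦm (CurveClass.measurableSet_rangeSubset isClosed_closure)]
  refine measure_congr ?_
  have hfull : ∀ᵐ γ ∂(P D), γ.range ⊆ closure D.carrier := by
    filter_upwards [(hch D).2] with γ hγ using hγ.2.2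
  filter_upwards [hfull] with γ hγ
  -- membership in the two events agrees for curves inside `closure D`
  have key : (γ ∈ CurveClass.rangeSubset (closure D'.carrier)) ↔
      (γ ∈ CurveClass.map Φ ⁻¹' CurveClass.rangeSubset (closure D₂'.carrier)) := by
    rw [mem_preimage, CurveClass.mem_rangeSubset, CurveClass.mem_rangeSubset, CurveClass.range_map,
      ← hcl]
    constructor
    · intro h
      exact image_mono h
    · intro h x hx
      obtain ⟨y, hy, hyx⟩ := h (mem_image_of_mem _ hx)
      have hyD : y ∈ closure D.carrier := closure_mono hsub hy
      rwa [← hinj hyD (hγ hx) hyx]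
  exact propext key


/-- **`Rigidity` ↔ scalar core.** The crux `Rigidity` (restriction + restriction-coupled Markov +
reversibility + lattice similarities + conjugation + simple boundary-avoiding curves ⇒ conformal
covariance) is equivalent to conformal invariance of the avoidance cocycle under the same hypotheses
(the registered stub `stub_cocycleConformal` of line `registered`): `→` is `core_of_rigidity`, `←` is
the landed reduction `rigidity_of_cocycleCore` (p149643, assembled from `stub_closureHomeomorph`,
`stub_pushforwardCarried`, `stub_preimageSubdomain`, `stub_covarianceOfCocycle` and
`AvoidanceDeterminesLaw_proof`). [folklore] -/
theorem rigidity_iff_cocycleCore : Summit.CriticalPhenomena.SAWScalingLimit.Theses.SAWRestrictionRigidity.Rigidity ↔ (∀ P : Literature.Probability.RandomPlanarGeometry.ChordalFamily, P.IsChordal → P.IsRestriction → (∃ Q : Literature.Probability.RandomPlanarGeometry.DobrushinDomain → Literature.Probability.RandomPlanarGeometry.CurveClass ℂ → MeasureTheory.Measure (Literature.Probability.RandomPlanarGeometry.CurveClass ℂ), P.IsMarkovExtension Q ∧ ∀ (D : Literature.Probability.RandomPlanarGeometry.DobrushinDomain) (p : Literature.Probability.RandomPlanarGeometry.CurveClass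 ℂ) (D' : Literature.Probability.RandomPlanarGeometry.DobrushinDomain), D'.carrier ⊆ Literature.Probability.RandomPlanarGeometry.remainingDomain D p → D'.pt 0 = p.target → D'.pt 1 = D.pt 1 → ∀ T : Set (Literature.Probability.RandomPlanarGeometry.CurveClass ℂ), MeasurableSet T → P D' T * Q D p (Literature.Probability.RandomPlanarGeometry.CurveClass.rangeSubset (closure D'.carrier)) = Q D p (T ∩ Literature.Probability.RandomPlanarGeometry.CurveClass.rangeSubset (closure D'.carrier))) → (∀ D D' : Literature.Probability.RandomPlanarGeometry.DobrushinDomain, D'.carrier = D.carrier → D'.pt 0 = D.pt 1 → D'.pt 1 = D.pt 0 → P D' = (P D).map Literature.Probability.RandomPlanarGeometry.CurveClass.reverse) → (∀ (D : Literature.Probability.RandomPlanarGeometry.DobrushinDomain) (c : ℂ) (hc : c ≠ 0) (w : ℂ), (∃ (r : ℝ) (k : ℕ), 0 < r ∧ c = (r : ℂ) * Complex.I ^ k) → P (D.map (Literature.Probability.RandomPlanarGeometry.similarity c hc w)) = (P D).map (Literature.Probability.RandomPlanarGeometry.CurveClass.map (Literature.Probability.RandomPlanarGeometry.similarity c hc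 w : C(ℂ, ℂ)))) → (∀ D : Literature.Probability.RandomPlanarGeometry.DobrushinDomain, P (D.map Complex.conjLIE.toHomeomorph) = (P D).map (Literature.Probability.RandomPlanarGeometry.CurveClass.map (Complex.conjLIE.toHomeomorph : C(ℂ, ℂ)))) → (∀ D : Literature.Probability.RandomPlanarGeometry.DobrushinDomain, ∀ᵐ γ ∂(P D), γ ∈ Literature.Probability.RandomPlanarGeometry.CurveClass.simple ∧ γ.range ∩ frontier D.carrier ⊆ {D.pt 0, D.pt 1}) → ∀ (D D₂ : Literature.Probability.RandomPlanarGeometry.DobrushinDomain) (g : Literature.Probability.RandomPlanarGeometry.ConformalEquiv D.carrier D₂.carrier) (Φ : C(ℂ, ℂ)), g.HasBoundaryValue (D.pt 0) (D₂.pt 0) → g.HasBoundaryValue (D.pt 1) (D₂.pt 1) → Set.EqOn Φ g D.carrier → Set.InjOn Φ (closure D.carrier) → ∀ (D' D₂' : Literature.Probability.RandomPlanarGeometry.DobrushinDomain), D'.carrier ⊆ D.carrier → D'.pt 0 = D.pt 0 → D'.pt 1 = D.pt 1 → D₂'.carrier ⊆ D₂.carrier → D₂'.pt 0 = D₂.pt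 0 → D₂'.pt 1 = D₂.pt 1 → (∃ ε : ℝ, 0 < ε ∧ D'.carrier ∩ Metric.ball (D.pt 0) ε = D.carrier ∩ Metric.ball (D.pt 0) ε ∧ D'.carrier ∩ Metric.ball (D.pt 1) ε = D.carrier ∩ Metric.ball (D.pt 1) ε) → (∃ ε : ℝ, 0 < ε ∧ D₂'.carrier ∩ Metric.ball (D₂.pt 0) ε = D₂.carrier ∩ Metric.ball (D₂.pt 0) ε ∧ D₂'.carrier ∩ Metric.ball (D₂.pt 1) ε = D₂.carrier ∩ Metric.ball (D₂.pt 1) ε) → Φ '' closure D'.carrier = closure D₂'.carrier → P D (Literature.Probability.RandomPlanarGeometry.CurveClass.rangeSubset (closure D'.carrier)) = P D₂ (Literature.Probability.RandomPlanarGeometry.CurveClass.rangeSubset (closure D₂'.carrier))) :=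
  ⟨core_of_rigidity, rigidity_of_cocycleCore⟩

end Summit.CriticalPhenomena.SAWScalingLimit.Cruxes.Rigidity.Cocycle

end
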